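import Summits.BirchSwinnertonDyer.BirchSwinnertonDyer.Theorems.QuadraticBranchSignedControlPlusEtaNonsurjLambdaTransferRecords
import Literature.NumberTheory.EllipticCurves.ModularCurvePeriodRatio
import Literature.NumberTheory.EllipticCurves.ModularCurveMinusPeriodRatio
import HarnessLib

/-!
# Route `QuadraticBranchSignedControl` (rung K8, cell `bsd-potss`), residual crux `PlusEtaMainConjectureNonsurj`
# (stmt-BirchSwinnertonDyer-19606): Part XLVIII — THE PERIOD INPUT OF THE BINDER THEOREM FROM NAMED FACTS: `hper` (a `p`-integral period
# ratio of the parity of `η` for every good `a_p = 0` curve) from Greenberg–Vatsal §3 Rem. 3.4 in both parities — the plus fact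
# `realPeriodRat_eq_unit_mul_plusPeriod` (`p ≡ 1 (mod 4)`) and the minus fact `numRealComponents_mul_imaginaryPeriodRat_eq_unit_mul_minusPeriod_of_odd`
# (this seat's append, `p ≡ 3 (mod 4)`); hence the v7 binder and the v7 composition from NAMED FACTS ONLY (seat `bsd-potss-k8eta-c2` g33)

WHY. Part XLVI proved `CorpuzLei2025_etaPlusMainConjecture_transfer_anMu_OPEN` from `h46 h53 h22 h41 hnf` and ONE displayed ∀-input `hper`.
`hper` is itself print: the Néron period of the parity of `η` is a `p`-adic unit times the lattice period of the newform for `p ∤ N` odd with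
`E[p]` irreducible (irreducibility is automatic at a good supersingular `p`, Serre). So after this file the binder — and v7's `_of` with its
slot filled — depend on NAMED Literature facts only (`h46 h53 h22 h41 hnf hGV hGVm [h26 h6273]`), which is the shape a planner can register as
the cite-level stub `stub_etaMC_publishedInputs` of a v8 skeleton.

WHAT. §140 `periodRatio_integral_of_periodFacts` (the `hper` statement from `hGV` + `hGVm`; `p ≡ 1 (4)` ⟹ `p ≥ 5` and the plus period;
`p ≡ 3 (4)` ⟹ the minus period with `ϖ = c_∞(V)/u`, `‖ϖ‖_p ≤ 1` since `c_∞ ∈ ℕ`); §141 `corpuzLei2025_etaPlusMainConjecture_transfer_anMu_of_citeFacts`;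
§142 `plusEtaMainConjectureNonsurj_of_cmConjA_of_analyticMu_of_uncongruent_of_citeFacts` (v7's `_of`, cite facts + the three content stubs).

HONEST FRAMING (cell `bsd-potss`; FULL-BSD rank ≤ 1 programme, HUMAN RULING D-0036/D-0074): BOOKKEEPING THEOREMS ONLY — no definition, no named
fact minted here, no `sorry`, axioms standard; CONDITIONAL on the displayed named facts. No stub of 19606 is closed; the crux and the route stay
OPEN; nothing is booked; `BSD(W, p)` is claimed for no pair. `--supports stmt-BirchSwinnertonDyer-19606`.

References: [GreenbergVatsal2000] §3 Remark 3.4; [Mazur1978] Cor. 4.1; [AbbesUllmo1996] Thm. A; [EdixhovenManin1991] Prop. 2; [Pal2012] p. 1514;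
[Serre1972] §1.11 Prop. 12; [HatleyLei2019] Thm. 4.6, Prop. 5.1; [CorpuzLei2025] Thm. 5.3; [Kobayashi2003] Thm. 2.2, Thm. 4.1, Thm. 6.2–7.3;
[BurungaleTian2026] Thm. 2.6.
-/

set_option autoImplicit false
set_option linter.dupNamespace false
noncomputable section

open scoped Classical

open CongruenceSubgroup Field NumberField IsDedekindDomain WeierstrassCurve
open Literature.NumberTheory.EllipticCurves
open Literature.NumberTheory.EllipticCurves.ModularForms
open Literature.NumberTheory.GaloisRepresentations
open Literature.NumberTheory.EllipticCurves.IwasawaAlgebra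
open Literature.NumberTheory.EllipticCurves.GreenbergVatsal2000
open ZpExtension
open Summit.BirchSwinnertonDyer.Rank1Residual.Additive
open Summit.BirchSwinnertonDyer.Rank1Residual.O6 (ModPCongruent)
open Summit.BirchSwinnertonDyer.BirchSwinnertonDyer.Theses.QuadraticBranchSignedControl

namespace Summit.BirchSwinnertonDyer.BirchSwinnertonDyer.Theorems.EtaLambdaTransfer

/-! ## §140 The period input `hper` from the two Greenberg–Vatsal period facts -/

/-- **A `p`-INTEGRAL period ratio of the parity of `η` exists for every good `a_p = 0` curve, `p` odd**, GRANTED the named facts `hGV`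
(`realPeriodRat_eq_unit_mul_plusPeriod`: `Ω(V) = u·Ω⁺_f`, `|u|_p = 1`, `p ≥ 5` good, `E[p]` irreducible) and `hGVm`
(`numRealComponents_mul_imaginaryPeriodRat_eq_unit_mul_minusPeriod_of_odd`: `c_∞(V)·|Ω⁻(V)| = u·Ω⁻_f`, `|u|_p = 1`, `p` odd good, irreducible):
if `(p−1)/2` is even (`p ≡ 1 (mod 4)`, hence `p ≥ 5`) take `ϖ = u⁻¹`; otherwise take `ϖ = c_∞(V)/u` (`c_∞ ∈ {1,2}`, so `‖ϖ‖_p ≤ 1`). Irreducibility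
of `E[p]` at a good supersingular odd `p` is Serre's Prop. 12 (tree theorem). This is VERBATIM the hypothesis `hper` of Part XLVI.
[cite: GreenbergVatsal2000, §3, Remark 3.4] [cite: Mazur1978, Cor. 4.1] [cite: Pal2012, p. 1514] [cite: Serre1972, §1.11 Prop. 12] -/
theorem periodRatio_integral_of_periodFacts (hGV : realPeriodRat_eq_unit_mul_plusPeriod)
    (hGVm : numRealComponents_mul_imaginaryPeriodRat_eq_unit_mul_minusPeriod_of_odd) :
    ∀ (V' : WeierstrassCurve ℚ) [V'.IsElliptic] [V'.IsGloballyMinimal] (p : ℕ) [Fact p.Prime]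
        {N' : ℕ} [NeZero N'] (f' : CuspForm (Gamma0 N') 2),
        p ≠ 2 → V'.HasGoodReductionAtPrime p → V'.frobeniusTrace p = 0 → IsNewformOf V' f' →
      ∃ ϖ' : ℚ, ‖(ϖ' : ℚ_[p])‖ ≤ 1 ∧
        (if Even (p / 2) then (ϖ' : ℝ) * V'.realPeriodRat = plusPeriod f'
          else (ϖ' : ℝ) * V'.imaginaryPeriodRat = minusPeriod f') := by
  intro V' _ _ p hp N' _ f' hp2 hgood hap hf
  have hirr : V'.HasIrreducibleModPGaloisRep p :=
    hasIrreducibleModPGaloisRep_of_dvd_frobeniusTrace V' p hp2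
      (not_dvd_minimalDiscriminantInt_of_hasGoodReductionAtPrime' V' p hgood) (hap ▸ dvd_zero _)
  by_cases heven : Even (p / 2)
  · -- `p ≡ 1 (mod 4)`, so `p ≥ 5`: the plus period
    have hp3 : p ≠ 3 := by rintro rfl; exact absurd heven (by decide)
    have hp5 : 5 ≤ p := hp.out.five_le_of_ne_two_of_ne_three hp2 hp3
    obtain ⟨u, hu, hΩ⟩ := hGV V' p hp5 hgood hirr f' hf
    have hu0 : u ≠ 0 := by rintro rfl; rw [Rat.cast_zero, norm_zero] at hu; exact zero_ne_one hu
    refine ⟨u⁻¹, by rw [Rat.cast_inv, norm_inv, hu, inv_one], ?_⟩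
    rw [if_pos heven, hΩ, Rat.cast_inv, inv_mul_cancel_left₀ (Rat.cast_ne_zero.mpr hu0)]
  · -- `p ≡ 3 (mod 4)`: the minus period, components included
    obtain ⟨u, hu, hΩ⟩ := hGVm V' p hp2 hgood hirr f' hf
    have hu0 : u ≠ 0 := by rintro rfl; rw [Rat.cast_zero, norm_zero] at hu; exact zero_ne_one hu
    set c : ℕ := (V'.baseChange ℝ).numRealComponents with hc
    refine ⟨(c : ℚ) / u, ?_, ?_⟩
    · rw [Rat.cast_div, Rat.cast_natCast, norm_div, hu, div_one]
      exact_mod_cast Padic.norm_int_le_one (c : ℤ)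
    · rw [if_neg heven, Rat.cast_div, Rat.cast_natCast, div_mul_eq_mul_div, hΩ,
        mul_div_cancel_left₀ _ (Rat.cast_ne_zero.mpr hu0)]

/-! ## §141 The binder from named facts only -/

/-- **THE v7 BINDER FROM NAMED FACTS ONLY**: `CorpuzLei2025_etaPlusMainConjecture_transfer_anMu_OPEN` (= `Sig.stub_etaMC_transferCL25`) from
Hatley–Lei Thm. 4.6 + Prop. 5.1 (`h46`), Corpuz–Lei Thm. 5.3 (`h53`), Kobayashi Thm. 2.2η (`h22`) and 4.1η (`h41`), modularity (`hnf`), and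
Greenberg–Vatsal's period comparison in both parities (`hGV`, `hGVm`) — Part XLVI with §140. CONDITIONAL on these cite-level facts; the binder's
statement is unchanged; nothing booked. [claim: CorpuzLei2025, status: under-review] [cite: HatleyLei2019, Thm. 4.6, Prop. 5.1]
[cite: Kobayashi2003, Thm. 2.2 (p. 5), Thm. 4.1 (p. 8)] [cite: GreenbergVatsal2000, p. 4 and §3 Remark 3.4] [cite: Wiles1995, Thm. 0.4] -/
theorem corpuzLei2025_etaPlusMainConjecture_transfer_anMu_of_citeFacts
    (h46 : HatleyLei2019.thm46_prop51_etaSignedMuLambda_transfer_of_torsionIso)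
    (h53 : CorpuzLei2025.thm53_etaPlusAnalyticMuLambda_transfer_of_torsionIso)
    (h22 : Kobayashi2003.thm22_etaSignedSelmerDual_finite_torsion)
    (h41 : Kobayashi2003.thm41_plusEtaCharIdeal_dvd)
    (hnf : exists_isNewformOf) (hGV : realPeriodRat_eq_unit_mul_plusPeriod)
    (hGVm : numRealComponents_mul_imaginaryPeriodRat_eq_unit_mul_minusPeriod_of_odd) :
    CorpuzLei2025_etaPlusMainConjecture_transfer_anMu_OPEN :=
  corpuzLei2025_etaPlusMainConjecture_transfer_anMu_of_invariantFacts h46 h53 h22 h41 hnf (periodRatio_integral_of_periodFacts hGV hGVm)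

/-! ## §142 v7's composition with the binder slot filled by named facts only -/

/-- **THE CRUX FROM v7's THREE CONTENT STUBS + NAMED FACTS ONLY** — Part XLVII §138 with `hper` supplied by §140: GRANTED (hypothesis position)
`h22 h6273 h26` (v7's `stub_etaMC_publishedInputs`) and `h46 h53 h41 hnf hGV hGVm` (what replaces v7's `stub_etaMC_transferCL25`), the crux
`PlusEtaMainConjectureNonsurj` follows from (A) on the CM partners, the analytic `μ = 0` on the CM rows, and (C1⁺_η) on the uncongruent non-CM
rows — all three VERBATIM v7's content stubs. CONDITIONAL; registers / closes no stub; nothing booked.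
[cite: Kobayashi2003, Thm. 2.2 (p. 5), §4 + Thm. 4.1 (p. 8), Thm. 6.2–7.3, Cor. 7.2] [cite: BurungaleTian2026, Thm. 2.6]
[cite: HatleyLei2019, Thm. 4.6, Prop. 5.1] [claim: CorpuzLei2025, status: under-review] [cite: GreenbergVatsal2000, §3 Remark 3.4]
[cite: CoatesSujatha2005, §3 statement (A)] -/
theorem plusEtaMainConjectureNonsurj_of_cmConjA_of_analyticMu_of_uncongruent_of_citeFacts
    (h22 : Kobayashi2003.thm22_etaSignedSelmerDual_finite_torsion)
    (h6273 : Kobayashi2003.thm62_63_73_etaColemanPoitouTate)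
    (h26 : BurungaleTian2026.thm26_etaKatoSequences_charIdeal_upToP_of_cm)
    (h46 : HatleyLei2019.thm46_prop51_etaSignedMuLambda_transfer_of_torsionIso)
    (h53 : CorpuzLei2025.thm53_etaPlusAnalyticMuLambda_transfer_of_torsionIso)
    (h41 : Kobayashi2003.thm41_plusEtaCharIdeal_dvd)
    (hnf : exists_isNewformOf) (hGV : realPeriodRat_eq_unit_mul_plusPeriod)
    (hGVm : numRealComponents_mul_imaginaryPeriodRat_eq_unit_mul_minusPeriod_of_odd)
    (hAcm : ∀ (V : WeierstrassCurve ℚ) [V.IsElliptic] [V.IsGloballyMinimal] (W : WeierstrassCurve ℚ) [W.IsElliptic]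
        [W.IsGloballyMinimal] (C : VariableChange ℚ) (p : ℕ) [Fact p.Prime],
        5 ≤ p → C • W.quadraticTwist ((-1) ^ (p / 2) * p) = V →
        V.HasGoodReductionAtPrime p → V.frobeniusTrace p = 0 →
        ¬ (∀ m : ℕ, V.HasSurjectiveModNGaloisRep (p ^ m : ℕ)) → V.HasCM →
        ∀ (κ : ZpExtension ℚ p), κ.IsCyclotomic →
          ∃ (γ : absoluteGaloisGroup ℚ) (D : W.FineSelmerDualData κ γ),
            Module.Finite ℤ_[p] (RestrictScalars ℤ_[p] (IwasawaAlgebra p) D.X))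
    (hμcm : ∀ (V : WeierstrassCurve ℚ) [V.IsElliptic] [V.IsGloballyMinimal] (p : ℕ) [Fact p.Prime],
        5 ≤ p → V.HasGoodReductionAtPrime p → V.frobeniusTrace p = 0 →
        ¬ (∀ m : ℕ, V.HasSurjectiveModNGaloisRep (p ^ m : ℕ)) → V.HasCM →
        ∀ {N : ℕ} [NeZero N] {f : CuspForm (Gamma0 N) 2}, IsNewformOf V f →
          ∀ (ϖ : ℚ), (if Even (p / 2) then (ϖ : ℝ) * V.realPeriodRat = plusPeriod f
              else (ϖ : ℝ) * V.imaginaryPeriodRat = minusPeriod f) →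
          ∀ (Lη : IwasawaAlgebra p), IsQuadraticBranchPlusLFunction f p ϖ Lη → HasUnitContent Lη)
    (huncong : ∀ (V : WeierstrassCurve ℚ) [V.IsElliptic] [V.IsGloballyMinimal] (p : ℕ) [Fact p.Prime],
        5 ≤ p → V.HasGoodReductionAtPrime p → V.frobeniusTrace p = 0 →
        ¬ (∀ m : ℕ, V.HasSurjectiveModNGaloisRep (p ^ m : ℕ)) → ¬ V.HasCM →
        ¬ (∃ (V'' : WeierstrassCurve ℚ) (_ : V''.IsElliptic) (_ : V''.IsGloballyMinimal),
            V''.HasCM ∧ V''.HasGoodReductionAtPrime p ∧ V''.frobeniusTrace p = 0 ∧ ModPCongruent V'' V p) →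
        QuadraticBranchPlusEtaMainConjectureAt V p) :
    PlusEtaMainConjectureNonsurj :=
  EtaLambdaTransferRecords.plusEtaMainConjectureNonsurj_of_cmConjA_of_analyticMu_of_uncongruent_of_invariantFacts h22 h6273 h26 h46 h53
    h41 hnf (periodRatio_integral_of_periodFacts hGV hGVm) hAcm hμcm huncong

end Summit.BirchSwinnertonDyer.BirchSwinnertonDyer.Theorems.EtaLambdaTransfer

end
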